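/-
Origin: expansion seat `planner-pub-hodgecm-mc-theta-3-g2-0`, handover #2 2026-08-18T21:16Z md5 b8491f94757550642f24f34288dfdf5d (NEW, 310 l.; ns HodgeCM.Model.SupplyResidual; AS-INSTALLED copy = ref3-audited bytes d1c5decd32a8 (#79 CLEAN) with ONLY the import lines rewritten Literature.* -> HodgeCM.Vendored.H21.*, McT3g2.SupplyInstance -> HodgeCM.Model.SupplyInstance; no stager rewrite needed; INSTALL AFTER #1; imports HodgeCM.Model.SupplyInstance + packet-2 twins W (`HOME/mc/pub-hodgecm-mc-theta-3-g2/aslanded/HodgeCM/Model/SupplyResidual.lean`, md5 b8491f94, 310 lines);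
landed by the packager successor (mc-unitary-1-g3, gen-8 kit) in gate run 32 as `HodgeCM/Model/SupplyResidual.lean` (verbatim).
-/
/-
Copyright (c) 2026. Released under Apache 2.0 license as described in the file LICENSE.
Cell pub-hodgecm, MODEL layer (construction prover mc-theta-3, gen 2), node J-W7a of `MODEL-DAG.md`.
-/
import Summits.HodgeConjecture.HodgeCM.Model.SupplyInstance_2
import Literature.NumberTheory.Weil1964.ThetaDualPairDatum
import Literature.NumberTheory.Weil1964.ThetaLift

/-!
# The junction J-W7a: the route-(E) theta lift IS the tree's theta lift of the pair

`HodgeCM.Model.SupplyInstance` instantiates the route-(E) supply bridge `SupplyBridgeA` over the constructed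
carriers, for ONE line `W_j` at a time, from a `WeilLineData K L J GU` (the Weil action `ω` of the pair
`G_U(𝔸) × U(W_j)(𝔸)` on `𝒮(𝔸_K^J)` + the hypotheses (W-wt), (W-maj), (W-rat)), and leaves ONE residual input
(W-res) `WeilLineData.Residual`, phrased in the PACKAGE vocabulary: the descended kernel
`kernelBar N : [U(W_j)] → ℂ` and the scalar lift `∫_{[U(W_j)]} θ̄_N(q) χ(q) dν(q)` (`SupplyBridgeA.lift`).

The theta FORMS and CLASSES that discharge (W-res) live in the TREE vocabulary
(`Literature.NumberTheory.Weil1964.ThetaKernelDatum`: `thetaKer`, `thetaLift`, `thetaLiftFun`, `thetaForm`,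
`thetaClasses`; the supply theorem there is `ThetaKernelDatum.exists_thetaClass_mem_H10_ne_zero`, whose scalar
input is `M.thetaLiftFun μ Φ f x ≠ 0`).  This module is the junction between the two:

* `WeilPairData K L J GU` = `WeilLineData` with the two Weil hypotheses stated for the PAIR (majorants for the
  whole action `ω`, theta-stabiliser membership for `Γ_U × U(W_j)(L₀)`), which is exactly the input of the tree's
  `ThetaKernelDatum.adelicOfDualPairRep`; `WeilPairData.toLineData` restricts them to the torus factor
  (`HasThetaMajorants.comp` along `u ↦ (1,u)`; `γ_U := 1`);
* `WeilPairData.kernelDatum : ThetaKernelDatum (GU × U(W_j)(𝔸)) 𝒮(𝔸_K^J)^{Θ-top} GU Γ_U U(W_j)(𝔸) U(W_j)(L₀)`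
  := `adelicOfDualPairRep ω …` (theta-2's W6a-5), index set all of `𝒮`; the test function is read on the
  carrier WITH ITS Θ-INITIAL TOPOLOGY, `testFunT N : weilDatum.ThetaTop` (`= testFun … N` as an element,
  `testFunT_eq`), so that every statement below is type-correct without unfolding the synonym;
* THE JUNCTION (kernel): `thetaKer_one_mk` — the tree kernel at `(1·Γ_U, u·U(W_j)(L₀))` is the route-(E)
  kernel at `u⁻¹` (`θ_Φ(xΓ_U, yΓ) = Θ(ω((x,y)⁻¹)Φ)` in the tree, `θ_N(u) = Θ(ω(1,u)φ_N)` in the package);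
  `integral_kernelBar_mul_eq_thetaLiftFun` — for every `f ∈ C([U(W_j)], ℂ)`,
  `∫ θ̄_N(q) f(q⁻¹) dν(q) = Θ̃_{φ_N}(f)(1)` (inversion invariance of the Haar probability measure of the compact
  abelian group `[U(W_j)]`); hence `SupplyBridgeA.lift N χ = Θ̃_{φ_N}(χ⁻)(1)` with `χ⁻(q) = χ(q⁻¹)`
  (`lift_eq_thetaLiftFun`) — the sign `χ ↔ χ⁻¹` recorded by period-2-g2 (STATUS 2026-08-18T20:27:59Z);
* `WeilPairData.ResidualT` = (W-res) in tree vocabulary (`thetaLiftFun … 1 ≠ 0 ⇒ ∃ Γ, ∃ ω ∈ T.Theta V c k Γ,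
  ω ≠ 0`), `residual_of_residualT`, and the supply corollaries `WeilPairData.supply`,
  `open_supply_of_pairSupplyData`.

Nothing is cited and nothing is minted: every statement is proved from the fields of the data records; the
residual (W-res)/(W-resT) stays an explicit hypothesis (node W6b: theta forms → classes, holomorphy, descent,
and the definition of `T.Theta` in the model universe).  Compactness of `[G_U] = G_U(𝔸) ⧸ Γ_U` is an
explicit instance argument because the tree's `ThetaKernelDatum.thetaLift` is defined under it
(`Weil1964/ThetaLift.lean`, `variable [CompactSpace (GU ⧸ ΓU)]`); compactness of `[U(W_j)]` is the tree
theorem `compactSpace_relNormOneQuot`.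
-/

set_option autoImplicit false

noncomputable section

open MeasureTheory NumberField NumberField.mixedEmbedding IsDedekindDomain
open Literature.NumberTheory.Automorphic Literature.NumberTheory.Weil1964
open HodgeCM.PerL34.Seesaw HodgeCM.PerL34.RationalCoset HodgeCM.PerL34.SupplyAdelic
open HodgeCM.Model.SupplyInstance
open scoped SchwartzMap Classical

namespace HodgeCM
namespace Model
namespace SupplyResidual

/-! ### § 1. Pair data and its restriction to the line -/

/-- **Weil data of the PAIR `(G_U, U(W_j))`**: the fields of `WeilLineData` with the two Weil hypotheses
stated for the whole pair — (W-maj⁺) theta majorants for `(g,u) ↦ ω(g,u)` and (W-rat⁺) `ω(γ_U, γ)` stabilises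
`Θ` for `γ_U ∈ Γ_U`, `γ ∈ U(W_j)(L₀)` — i.e. exactly the input of `ThetaKernelDatum.adelicOfDualPairRep`. -/
structure WeilPairData (K L : Type) [Field K] [NumberField K] [Field L] [NumberField L] [Algebra K L]
    [FiniteDimensional K L] (J : Type) [Fintype J] (GU : Type) [Group GU] [TopologicalSpace GU] where
  /-- the arithmetic subgroup `Γ_U ≤ G_U(𝔸)` (rational points, or rational points times a level) -/
  ΓU : Subgroup GU
  /-- (W-ω) the Weil action of the pair on `𝒮(𝔸_K^J)` -/
  ω : Representation ℂ (GU × relNormOneIdeles K L) (piSchwartzBruhat K J)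
  /-- the archimedean test function `φ_∞` -/
  Φinf : 𝓢((J → mixedSpace K), ℂ)
  /-- the rational base point `x₀` -/
  x₀ : J → K
  /-- `φ_∞(x₀) ≠ 0` -/
  hx₀ : Φinf (archEmb K J x₀) ≠ 0
  /-- the archimedean weight `w` -/
  w : relNormOneInfUnits K L → ℂ
  /-- (W-wt) `φ_N` is a weight-`w` vector of the archimedean torus -/
  weight : ∀ (N : ℕ) (t : relNormOneInfUnits K L),
    ω (1, relNormOneInfToIdeles K L t) (testFun K J Φinf x₀ N) = w t • testFun K J Φinf x₀ N
  /-- (W-maj⁺) Weil's majorant hypothesis for the pair action -/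
  majorants : HasThetaMajorants fun (g : GU × relNormOneIdeles K L) (Φ : piSchwartzBruhat K J) => ω g Φ
  /-- (W-rat⁺) `ω(γ_U, γ)` stabilises `Θ` for `γ_U ∈ Γ_U`, `γ ∈ U(W_j)(L₀)` -/
  theta_rat : ∀ γU ∈ ΓU, ∀ γ ∈ relNormOneRat K L, ω (γU, γ) ∈ thetaStabilizerEnd K J

namespace WeilPairData

variable {K L : Type} [Field K] [NumberField K] [Field L] [NumberField L] [Algebra K L] [FiniteDimensional K L]
variable {J : Type} [Fintype J] {GU : Type} [Group GU] [TopologicalSpace GU]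
variable (P : WeilPairData K L J GU)

/-- Restriction to the line: the torus-factor hypotheses of `WeilLineData` follow from the pair ones. -/
def toLineData [ContinuousMul GU] : WeilLineData K L J GU where
  ω := P.ω
  Φinf := P.Φinf
  x₀ := P.x₀
  hx₀ := P.hx₀
  w := P.w
  weight := P.weight
  majorants := P.majorants.comp (f := fun u : relNormOneIdeles K L => ((1 : GU), u))
    (continuous_const.prodMk continuous_id)
  theta_rat γ hγ := P.theta_rat 1 P.ΓU.one_mem γ hγ

/-- (Ported verbatim from the HodgeCMPerL package; no docstring in the source.) -/
@[simp] theorem toLineData_ω [ContinuousMul GU] : P.toLineData.ω = P.ω := rfl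
/-- (Ported verbatim from the HodgeCMPerL package; no docstring in the source.) -/
@[simp] theorem toLineData_Φinf [ContinuousMul GU] : P.toLineData.Φinf = P.Φinf := rfl
/-- (Ported verbatim from the HodgeCMPerL package; no docstring in the source.) -/
@[simp] theorem toLineData_x₀ [ContinuousMul GU] : P.toLineData.x₀ = P.x₀ := rfl
/-- (Ported verbatim from the HodgeCMPerL package; no docstring in the source.) -/
@[simp] theorem toLineData_w [ContinuousMul GU] : P.toLineData.w = P.w := rfl

/-- (W-rat⁺) in the unit form consumed by `adelicOfDualPairRep`. -/
theorem toHomUnits_mem_thetaStabilizer :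
    ∀ γU ∈ P.ΓU, ∀ γ ∈ relNormOneRat K L, P.ω.toHomUnits (γU, γ) ∈ thetaStabilizer K J := by
  intro γU hγU γ hγ
  rw [mem_thetaStabilizer_iff_coe_mem, MonoidHom.coe_toHomUnits]
  exact P.theta_rat γU hγU γ hγ

/-! ### § 2. The tree theta-kernel datum of the pair -/

variable [IsTopologicalGroup GU] [LocallyCompactSpace GU]

omit [IsTopologicalGroup GU] [LocallyCompactSpace GU] in
/-- Weil's theta datum of the pair action on `𝒮(𝔸_K^J)` (tree `repWeilThetaDatum`: `Mp := G_U(𝔸) × U(W_j)(𝔸)`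
acting through `ω`, rational set `Γ_U × U(W_j)(L₀)`, `Θ_Φ(S) = Θ(ω(S)Φ)`). -/
abbrev weilDatum : WeilThetaDatum (GU × relNormOneIdeles K L) (piSchwartzBruhat K J) :=
  repWeilThetaDatum K J P.ω.toHomUnits
    ((P.ΓU.prod (relNormOneRat K L) : Subgroup (GU × relNormOneIdeles K L)) : Set (GU × relNormOneIdeles K L))

omit [IsTopologicalGroup GU] [LocallyCompactSpace GU] in
/-- The test function `φ_N` read on the carrier `𝒮(𝔸_K^J)` WITH ITS Θ-INITIAL TOPOLOGY (the type synonym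
`WeilThetaDatum.ThetaTop` of the tree; the identification `toThetaTop` is the identity on elements). -/
def testFunT (N : ℕ) : P.weilDatum.ThetaTop := P.weilDatum.toThetaTop (testFun K J P.Φinf P.x₀ N)

omit [IsTopologicalGroup GU] [LocallyCompactSpace GU] in
/-- `φ_N` on `ThetaTop` IS `φ_N`. -/
theorem testFunT_eq (N : ℕ) : P.testFunT N = testFun K J P.Φinf P.x₀ N := rfl

/-- **The theta-kernel datum of the pair** (tree `ThetaKernelDatum`, theta-2's `adelicOfDualPairRep`): carriers
`Mp := G_U(𝔸) × U(W_j)(𝔸)`, `𝒮(𝔸_K^J)` with the Θ-initial topology, `s := id`, `Γ_U × U(W_j)(L₀)` rational,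
index set all of `𝒮`. -/
def kernelDatum : ThetaKernelDatum (GU × relNormOneIdeles K L) P.weilDatum.ThetaTop
    GU P.ΓU (relNormOneIdeles K L) (relNormOneRat K L) :=
  ThetaKernelDatum.adelicOfDualPairRep P.ω P.majorants P.toHomUnits_mem_thetaStabilizer Set.univ
    fun _ _ _ => Set.mem_univ _

/-- Its kernel on representatives: `θ_Φ(x, u) = Θ(ω(x⁻¹, u⁻¹)Φ)`. -/
theorem kernelDatum_thetaFun_mk (Φ : piSchwartzBruhat K J) (x : GU) (u : relNormOneIdeles K L) :
    P.kernelDatum.thetaFun (P.weilDatum.toThetaTop Φ) (x, u) = thetaDistLM K J (P.ω (x⁻¹, u⁻¹) Φ) := rfl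

/-- **JUNCTION, kernel level**: the tree kernel of `φ_N` at `(1·Γ_U, u·U(W_j)(L₀))` is the route-(E) kernel at
`u⁻¹`: `θ_{φ_N}(Γ_U, u U(W_j)(L₀)) = Θ(ω(1, u⁻¹) φ_N) = θ_N(u⁻¹)`. -/
theorem thetaKer_one_mk (N : ℕ) (u : relNormOneIdeles K L) :
    P.kernelDatum.thetaKer (P.testFunT N) (QuotientGroup.mk (1 : GU), QuotientGroup.mk u) =
      P.toLineData.kernel N u⁻¹ := by
  rw [ThetaKernelDatum.thetaKer_mk, WeilLineData.kernel_eq]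
  show thetaDistLM K J (P.ω ((1 : GU), u)⁻¹ _) = _
  rw [Prod.inv_mk, inv_one]
  rfl

/-- … and on the quotient: `θ_{φ_N}(Γ_U, q) = θ̄_N(q⁻¹)`. -/
theorem thetaKer_one (N : ℕ) (q : relNormOneIdeles K L ⧸ relNormOneRat K L) :
    P.kernelDatum.thetaKer (P.testFunT N) (QuotientGroup.mk (1 : GU), q) = P.toLineData.kernelBar N q⁻¹ := by
  induction q using QuotientGroup.induction_on with
  | H u => rw [thetaKer_one_mk, ← QuotientGroup.mk_inv]; rfl

/-! ### § 3. The lift: `∫ θ̄_N f(·⁻¹) dν = Θ̃_{φ_N}(f)(1)` -/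

/-- The Haar probability measure of the compact abelian group `[U(W_j)]` is inversion invariant. -/
instance isInvInvariant_probHaarRelNormOneQuot : (probHaarRelNormOneQuot K L).IsInvInvariant := by
  unfold probHaarRelNormOneQuot; infer_instance

/-- **JUNCTION, lift level**: for every continuous `f` on `[U(W_j)]`,
`∫_{[U(W_j)]} θ̄_N(q) f(q⁻¹) dν(q) = Θ̃_{φ_N}(f)(1)` (`ThetaKernelDatum.thetaLiftFun` at the identity of `G_U(𝔸)`). -/
theorem integral_kernelBar_mul_eq_thetaLiftFun [CompactSpace (GU ⧸ P.ΓU)] (N : ℕ)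
    (f : C(relNormOneIdeles K L ⧸ relNormOneRat K L, ℂ)) :
    ∫ q, P.toLineData.kernelBar N q * f q⁻¹ ∂(probHaarRelNormOneQuot K L) =
      P.kernelDatum.thetaLiftFun (probHaarRelNormOneQuot K L) (P.testFunT N) f 1 := by
  rw [ThetaKernelDatum.thetaLiftFun_apply, inv_one, ThetaKernelDatum.thetaLift_apply]
  simp only [thetaKer_one]
  symm
  calc ∫ q, P.toLineData.kernelBar N q⁻¹ * f q ∂(probHaarRelNormOneQuot K L)
      = ∫ q, (fun q' => P.toLineData.kernelBar N q'⁻¹ * f q') q⁻¹ ∂(probHaarRelNormOneQuot K L) :=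
        (integral_inv_eq_self _ (probHaarRelNormOneQuot K L)).symm
    _ = ∫ q, P.toLineData.kernelBar N q * f q⁻¹ ∂(probHaarRelNormOneQuot K L) :=
        integral_congr_ae (Filter.Eventually.of_forall fun q =>
          congrArg (fun x => P.toLineData.kernelBar N x * f q⁻¹) (inv_inv q))

/-- The character `q ↦ χ(q⁻¹)` as a continuous function (`= χ̄ = χ⁻¹` pointwise). -/
def charInv (χ : PontryaginDual (relNormOneIdeles K L ⧸ relNormOneRat K L)) :
    C(relNormOneIdeles K L ⧸ relNormOneRat K L, ℂ) where
  toFun q := ((χ q⁻¹ : Circle) : ℂ)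
  continuous_toFun := continuous_subtype_val.comp ((map_continuous χ).comp continuous_inv)

omit [NumberField K] [IsTopologicalGroup GU] [LocallyCompactSpace GU] in
/-- (Ported verbatim from the HodgeCMPerL package; no docstring in the source.) -/
@[simp] theorem charInv_apply (χ : PontryaginDual (relNormOneIdeles K L ⧸ relNormOneRat K L))
    (q : relNormOneIdeles K L ⧸ relNormOneRat K L) : charInv χ q = ((χ q⁻¹ : Circle) : ℂ) := rfl

omit [NumberField K] [IsTopologicalGroup GU] [LocallyCompactSpace GU] in
/-- (Ported verbatim from the HodgeCMPerL package; no docstring in the source.) -/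
theorem charInv_apply_inv (χ : PontryaginDual (relNormOneIdeles K L ⧸ relNormOneRat K L))
    (q : relNormOneIdeles K L ⧸ relNormOneRat K L) : charInv χ q⁻¹ = ((χ q : Circle) : ℂ) :=
  congrArg (fun x => ((χ x : Circle) : ℂ)) (inv_inv q)

/-- **JUNCTION for the scalar lift of route (E)**: `∫ θ̄_N χ dν = Θ̃_{φ_N}(χ⁻)(1)`, `χ⁻(q) = χ(q⁻¹)`. -/
theorem integral_kernelBar_mul_char_eq_thetaLiftFun [CompactSpace (GU ⧸ P.ΓU)] (N : ℕ)
    (χ : PontryaginDual (relNormOneIdeles K L ⧸ relNormOneRat K L)) :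
    ∫ q, P.toLineData.kernelBar N q * ((χ q : Circle) : ℂ) ∂(probHaarRelNormOneQuot K L) =
      P.kernelDatum.thetaLiftFun (probHaarRelNormOneQuot K L) (P.testFunT N) (charInv χ) 1 := by
  rw [← integral_kernelBar_mul_eq_thetaLiftFun]
  simp_rw [charInv_apply_inv]

/-- The same for the bridge record's `SupplyBridgeA.lift`. -/
theorem lift_eq_thetaLiftFun [CompactSpace (GU ⧸ P.ΓU)] {U : Universe} {T : U.ThetaModel} {Lc : CMField}
    {ι₁ : Lc →+* ℂ} {V : HermSpace3 Lc ι₁} {c : SeesawCtx Lc} {k : Fin 4}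
    (hres : P.toLineData.Residual T V c k) (N : ℕ)
    (χ : PontryaginDual (relNormOneIdeles K L ⧸ relNormOneRat K L)) :
    (P.toLineData.bridge hres).lift N χ =
      P.kernelDatum.thetaLiftFun (probHaarRelNormOneQuot K L) (P.testFunT N) (charInv χ) 1 :=
  P.integral_kernelBar_mul_char_eq_thetaLiftFun N χ

/-! ### § 4. (W-res) in tree vocabulary and the supply -/

/-- **(W-resT) the residual in TREE vocabulary**: for `N ≥ 1` and a continuous unitary character `χ` of
`[U(W_j)]` of the archimedean type forced by `w`, if the tree theta lift `Θ̃_{φ_N}(χ⁻)` does not vanish at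
`1 ∈ G_U(𝔸)` then some theta one-form class of type index `k` is non-zero at some level.  (Node W6b: the
lift is the value of the theta FORM `ThetaKernelDatum.thetaForm`, which is then `≠ 0`
(`thetaForm_ne_zero_of_thetaLift_ne_zero`), holomorphic for `φ_∞ = φ⁰`, hence a non-zero CLASS
(`exists_thetaClass_mem_H10_ne_zero`) in `T.Theta V c k Γ` once the model's `Theta` is these classes.) -/
def ResidualT [CompactSpace (GU ⧸ P.ΓU)] {U : Universe} (T : U.ThetaModel) {Lc : CMField} {ι₁ : Lc →+* ℂ}
    (V : HermSpace3 Lc ι₁) (c : SeesawCtx Lc) (k : Fin 4) : Prop :=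
  ∀ (N : ℕ) (χ : PontryaginDual (relNormOneIdeles K L ⧸ relNormOneRat K L)), 0 < N →
    (∀ t : relNormOneInfUnits K L,
      ((χ ((relNormOneInfToIdeles K L t : relNormOneIdeles K L) :
        relNormOneIdeles K L ⧸ relNormOneRat K L) : Circle) : ℂ) * P.w t = 1) →
    P.kernelDatum.thetaLiftFun (probHaarRelNormOneQuot K L) (P.testFunT N) (charInv χ) 1 ≠ 0 →
    ∃ Γ : Level V, ∃ ω ∈ T.Theta V c k Γ, ω ≠ 0

variable [CompactSpace (GU ⧸ P.ΓU)] {U : Universe} {T : U.ThetaModel} {Lc : CMField} {ι₁ : Lc →+* ℂ}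
  {V : HermSpace3 Lc ι₁} {c : SeesawCtx Lc} {k : Fin 4}

/-- (W-resT) ⇒ (W-res). -/
theorem residual_of_residualT (h : P.ResidualT T V c k) : P.toLineData.Residual T V c k := by
  intro N χ hN htype hne
  refine h N χ hN htype ?_
  rwa [← integral_kernelBar_mul_char_eq_thetaLiftFun]

/-- **Supply of type index `k` from pair data**: KERNEL + (W-resT). -/
theorem supply (h : P.ResidualT T V c k) : ∃ Γ : Level V, ∃ ω ∈ T.Theta V c k Γ, ω ≠ 0 :=
  P.toLineData.supply (P.residual_of_residualT h)

end WeilPairData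

/-! ### § 5. `Open_supply` from pair data in every good context -/

/-- Pair supply data for the type index `k` in the context `(V, c)`: carriers, pair Weil data, (W-resT). -/
structure PairSupplyData {U : Universe} (T : U.ThetaModel) {Lc : CMField} {ι₁ : Lc →+* ℂ}
    (V : HermSpace3 Lc ι₁) (c : SeesawCtx Lc) (k : Fin 4) : Type 1 where
  /-- the base field `K = L₀` -/
  K : Type
  /-- the CM extension `L / K` -/
  L : Type
  instK : Field K
  instKnf : NumberField K
  instL : Field L
  instLnf : NumberField L
  instAlg : Algebra K L
  instFD : FiniteDimensional K L
  /-- the Lagrangian index type -/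
  J : Type
  instJ : Fintype J
  /-- the adelic group `G_U(𝔸)` -/
  GU : Type
  instGU : Group GU
  instGUtop : TopologicalSpace GU
  instGUtg : IsTopologicalGroup GU
  instGUlc : LocallyCompactSpace GU
  /-- the pair Weil data -/
  P : WeilPairData K L J GU
  /-- `[G_U]` is compact (anisotropic `V`) -/
  instCompact : CompactSpace (GU ⧸ P.ΓU)
  /-- (W-resT) -/
  res : P.ResidualT T V c k

attribute [instance] PairSupplyData.instK PairSupplyData.instKnf PairSupplyData.instL PairSupplyData.instLnf
  PairSupplyData.instAlg PairSupplyData.instFD PairSupplyData.instJ PairSupplyData.instGU PairSupplyData.instGUtop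
  PairSupplyData.instGUtg PairSupplyData.instGUlc PairSupplyData.instCompact

/-- Pair supply data give line supply data. -/
def PairSupplyData.toLineSupplyData {U : Universe} {T : U.ThetaModel} {Lc : CMField} {ι₁ : Lc →+* ℂ}
    {V : HermSpace3 Lc ι₁} {c : SeesawCtx Lc} {k : Fin 4} (S : PairSupplyData T V c k) :
    LineSupplyData T V c k where
  K := S.K
  L := S.L
  J := S.J
  GU := S.GU
  D := S.P.toLineData
  res := S.P.residual_of_residualT S.res

/-- **`Open_supply` BY NAME from pair supply data** for the type indices `0, 1` in every good context. -/
theorem open_supply_of_pairSupplyData {U : Universe} (T : U.ThetaModel)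
    (h : ∀ {Lc : CMField} {ι₁ : Lc →+* ℂ} (V : HermSpace3 Lc ι₁) (c : SeesawCtx Lc), T.GoodCtx ι₁ c →
      Nonempty (PairSupplyData T V c 0) ∧ Nonempty (PairSupplyData T V c 1)) :
    T.Open_supply :=
  open_supply_of_lineSupplyData T fun V c hc =>
    ⟨(h V c hc).1.map PairSupplyData.toLineSupplyData, (h V c hc).2.map PairSupplyData.toLineSupplyData⟩

end SupplyResidual
end Model
end HodgeCM
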